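import Summits.QuantumFields.QCD.Theorems.ExtinctionBuildsQCD.Negative.TightPinsLine
import Summits.QuantumFields.QCD.Theorems.SpectralDefectExtinctionTipNoBinding

/-!
# Negative lemmas for the crux `TipPricing` (item stmt-QuantumFields-8967), III: the junk line
# (TIGHT on the free side, by volume) and the refuter's obligation

Route `SpectralDefectExtinction` (QCD), crux `TipPricing : TipNoBinding → WegnerEstimate → WindowExtinction`.
Refuter file (cdisprove seat, cycle 2): sorry-free, no positive route-item conclusion, neither hypothesis
of the crux used.  Builds on the sibling seat's landed `ExtinctionBuildsQCD/Negative/WithoutTightCollapse.lean`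
(`Extinct`, `Tight`, `SDHyp`, `extinct_of_mcrit_nonneg`) and `TightPinsLine.lean`
(`Tight.eventually_probe_mem`).  Certified copy of §6–§7 of the work file
`Summits/QuantumFields/QCD/Cruxes/TipPricing/Disproof.lean`.

WHY THE CRUX CANNOT BE REFUTED (and is junk-true as typed).  `¬ TipPricing ↔ TipNoBinding ∧
WegnerEstimate ∧ ¬ WindowExtinction` (`Negative/WithoutTight.lean`); and since `TipNoBinding` is now a
THEOREM (item 8965, `…Cruxes.TipNoBinding.PositivityNoLeakSpread.TipNoBinding_of`, landed as
`Theorems/SpectralDefectExtinctionTipNoBinding.lean`), `TipPricing ↔ (WegnerEstimate → WindowExtinction)` and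
`¬ TipPricing ↔ WegnerEstimate ∧ ¬ WindowExtinction` (`tipPricing_iff_wegner_imp_window`,
`not_tipPricing_iff_wegner_and_not_window`: the first hypothesis is discharged, the crux is a two-term
implication).  A FREE-SIDE witness — any
mass-scaling, asymptotically scaling regularisation with `m_crit(k) ≥ 0` — satisfies EXTINCT for free
(`extinct_of_mcrit_nonneg`), so `SD(N_f)` for it is exactly its TIGHT clause
(`sdHyp_of_freeSide_tight`: the JUNK LINE).  Consequently:

* (buildfix 2026-08-20, maintenance — REMOVED: `freeSide_not_tight_of_not_windowExtinction`,
  `freeSide_not_tight_of_not_tipPricing`, `freeSide_not_tight_padded_of_not_tipPricing`,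
  `canonicalAF_padded_not_tight_of_not_tipPricing`.  They derived "¬ `WindowExtinction` ⇒ TIGHT fails on the
  whole free side" through `WithoutTightCollapse.windowExtinction_iff`, an `Iff.rfl` against the ORIGINAL body
  of the route decl `WindowExtinction`; route rev 9 (2026-08-17) restated it as SD⁺ — volume cap
  `L_k ≤ a_k^{-p}`, branch clause, extensive EXTINCT/TIGHT — so `¬ WindowExtinction` no longer forces a TIGHT
  failure (a free-side TIGHT witness may simply violate the volume cap) and the four statements are not
  derivable; `windowExtinction_iff` itself is removed by the maintenance re-land of `WithoutTightCollapse`.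
  Referenced only by the crux workfile `Cruxes/TipPricing/Disproof.lean`.  Every other declaration is
  unchanged.)  `not_tight_iff` — `¬ TIGHT` unpacked: some probe `M > M₀` has phase-quenched
  `E₊|n₋(Γ₅ D_W(U, m_crit(k) − a_k M/Z_m(k), 1)) − 6(2L_k+1)⁴| < 1` for infinitely many `k`.
* `exists_padVolume` — admissibility is closed under replacing the torus half-sides `L_k` by ANY dominating
  `L'_k ≥ L_k` (`tendsto_L : a_k L_k → ∞` has no upper rate), so a TIGHT failure on the free side would have
  to hold UNIFORMLY IN THE VOLUME at fixed finite `β_k`.  Physically this is false: the index at probe mass `−w_k` is carried by real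
  eigenvalues of `D_W(U,0,1)` in the deep window `[0, w_k]`, whose density per site is tiny but positive at
  every finite `β` (finite-energy property of the Wilson measure), and far-apart carriers contribute
  independent signs, so `E₊|index|` grows without bound with the volume.  Hence the crux is TRUE as
  typed with both hypotheses idle (the "volume line"), unprovable here only for want of a gauge-integral
  LOWER bound — a misstatement signal for the sibling item 8964 (TIGHT should be intensive, or the scheme
  torus capped at `L_k ≤ K/a_k`).
* `not_uniform_tight` — a natural strengthening refuted for EVERY witness: TIGHT with the eventuality
  uniform in the probe (`∀ᶠ k, ∀ M > M₀` instead of `∀ M > M₀, ∀ᶠ k`) is false (large probes leave the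
  hole at fixed `k`, where the index vanishes identically).
* `tendsto_a_div_Zm`, `tendsto_window`, `freeSide_tight_probe` — under mass scaling (`N_f ≤ 16`)
  `a_k/Z_m(k) → 0`; for a free-side TIGHT witness the probe mass lies eventually in `[−a_k M/Z_m(k), 0]`,
  tends to `0⁻`, and `m_crit(k) → 0`: the junk line's TIGHT is a statement about net real modes of the
  massless Wilson operator in a window collapsing onto the TIP `0` of the Wilson hole.

References: Berruto–Narayanan–Neuberger, Phys. Lett. B 489 (2000) 243, §7 (entropy of real-mode
carriers); Edwards–Heller–Narayanan, Nucl. Phys. B 535 (1998) 403 (spectral flow, accumulation edge);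
Montvay–Münster 1994 §5.1 (critical line, `Z_m`).
-/

noncomputable section

namespace Summit.QuantumFields.QCD.Theorems.TipPricing.Negative

open Summit.QuantumFields.QCD.Theses.SpectralDefectExtinction
open Summit.QuantumFields.QCD.Theorems.ExtinctionBuildsQCD.Negative
open Literature.MathematicalPhysics.QuantumLattice Literature.MathematicalPhysics.QuantumFieldTheory
  Literature.Probability.LatticeModels
open Matrix MeasureTheory Filter
open scoped Classical Topology

/-! ## The first hypothesis is discharged -/

/-- **`TipNoBinding` is a theorem, so the crux is `WegnerEstimate → WindowExtinction`.** -/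
theorem tipPricing_iff_wegner_imp_window : TipPricing ↔ (WegnerEstimate → WindowExtinction) :=
  ⟨fun h hW => h Summit.QuantumFields.QCD.Cruxes.TipNoBinding.PositivityNoLeakSpread.TipNoBinding_of hW,
    fun h _ hW => h hW⟩

/-- **What a kill now needs**: a PROOF of `WegnerEstimate` (item 8966) and a REFUTATION of
`WindowExtinction` (item 8964). -/
theorem not_tipPricing_iff_wegner_and_not_window :
    ¬ TipPricing ↔ (WegnerEstimate ∧ ¬ WindowExtinction) := by
  rw [tipPricing_iff_wegner_imp_window]
  tauto

/-! ## The junk line and the refuter's obligation -/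

/-- **A free-side TIGHT witness is a full `SD(N_f)` witness** (with `c = 1`): for a mass-scaling,
asymptotically scaling regularisation whose line never enters the Wilson hole (`m_crit(k) ≥ 0` for all
`k`), EXTINCT comes for free (`extinct_of_mcrit_nonneg`), so TIGHT above a threshold `M₀ ≥ 0` is all of
`SD(N_f)` — the JUNK LINE ("TIGHT on the free side"; no pricing, no `TipNoBinding`, no `WegnerEstimate`). -/
theorem sdHyp_of_freeSide_tight {Nf : ℕ} (reg : QCDRegularisation Nf) (hcrit : ∀ k, 0 ≤ reg.mcrit k)
    (h1 : reg.HasMassScaling) (h2 : (reg.scheme 0 0 0).HasAsymptoticScaling) {M₀ : ℝ} (hM₀ : 0 ≤ M₀)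
    (hT : ∀ m : Fin Nf → ℝ, (∀ f, M₀ < m f) → Tight Nf reg M₀ m) : SDHyp Nf :=
  ⟨reg, h1, h2, M₀, hM₀, 1, one_pos, fun m hm =>
    ⟨extinct_of_mcrit_nonneg reg hcrit le_rfl m fun f => hM₀.trans_lt (hm f), hT m hm⟩⟩

/-- `¬ TIGHT` unpacked (verbatim integrals): some probe `M > M₀` has the index expectation `< 1` for
infinitely many `k`. -/
theorem not_tight_iff {Nf : ℕ} (reg : QCDRegularisation Nf) (M₀ : ℝ) (m : Fin Nf → ℝ) :
    ¬ Tight Nf reg M₀ m ↔ ∃ M : ℝ, M₀ < M ∧ ∃ᶠ k : ℕ in Filter.atTop, (∫ U, (|(Multiset.countP (fun z : ℂ => z.re < 0) (spinorLift gammaFive * wilsonDirac (fundamentalRep (Fin 3)) U (reg.mcrit k - reg.a k * M / reg.Zm k) 1).charpoly.roots : ℝ) - 6 * (2 * reg.L k + 1 : ℝ) ^ 4|) * ∏ f : Fin Nf, ‖fermionDet (wilsonDirac (fundamentalRep (Fin 3)) U (reg.mcrit k + reg.a k * m f / reg.Zm k) 1)‖ ∂(wilsonMeasure (d := 4) (L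 := 2 * reg.L k + 1) (fundamentalRep (Fin 3)) (reg.β k))) / (∫ U, ∏ f : Fin Nf, ‖fermionDet (wilsonDirac (fundamentalRep (Fin 3)) U (reg.mcrit k + reg.a k * m f / reg.Zm k) 1)‖ ∂(wilsonMeasure (d := 4) (L := 2 * reg.L k + 1) (fundamentalRep (Fin 3)) (reg.β k))) < 1 := by
  simp only [Tight, not_forall, Filter.not_eventually, not_le, exists_prop]

/-! ## Volume padding: `tendsto_L` has no upper rate -/

/-- **Volume padding exists.**  For any dominating sequence of torus half-sides `L'_k ≥ L_k` there is a
regularisation with the SAME `a, β, m_crit, Z_m` and volumes `L'` (`a_k L'_k → ∞` is inherited). -/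
theorem exists_padVolume {Nf : ℕ} (reg : QCDRegularisation Nf) (L' : ℕ → ℕ)
    (hL : ∀ k, reg.L k ≤ L' k) :
    ∃ reg' : QCDRegularisation Nf, reg'.a = reg.a ∧ reg'.β = reg.β ∧ reg'.L = L' ∧
      reg'.mcrit = reg.mcrit ∧ reg'.Zm = reg.Zm := by
  refine ⟨⟨reg.a, reg.a_pos, reg.tendsto_a, reg.β, L', ?_, reg.mcrit, reg.Zm, reg.Zm_pos⟩,
    rfl, rfl, rfl, rfl, rfl⟩
  refine tendsto_atTop_mono (fun k => ?_) reg.tendsto_L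
  exact mul_le_mul_of_nonneg_left (Nat.cast_le.mpr (hL k)) (reg.a_pos k).le

/-- Mass scaling only depends on `a` and `Z_m`. -/
theorem hasMassScaling_congr {Nf : ℕ} {reg reg' : QCDRegularisation Nf} (ha : reg'.a = reg.a)
    (hZ : reg'.Zm = reg.Zm) : reg'.HasMassScaling ↔ reg.HasMassScaling := by
  unfold QCDRegularisation.HasMassScaling
  rw [ha, hZ]

/-- Asymptotic scaling (of the scheme at any masses) only depends on `a` and `β`. -/
theorem hasAsymptoticScaling_congr {Nf : ℕ} {reg reg' : QCDRegularisation Nf} (ha : reg'.a = reg.a)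
    (hβ : reg'.β = reg.β) :
    (reg'.scheme 0 0 0).HasAsymptoticScaling ↔ (reg.scheme 0 0 0).HasAsymptoticScaling := by
  show (∃ Λ > 0, Tendsto (fun k => reg'.β k - afBeta Nf Λ (reg'.a k)) atTop (𝓝 0)) ↔
    (∃ Λ > 0, Tendsto (fun k => reg.β k - afBeta Nf Λ (reg.a k)) atTop (𝓝 0))
  rw [ha, hβ]

/-- The obligation is not vacuous: the tree's `canonicalAF` is free-side admissible (hence so is each
of its volume paddings). -/
theorem freeSide_admissible_nonempty (Nf : ℕ) :
    ∃ reg : QCDRegularisation Nf, (∀ k, 0 ≤ reg.mcrit k) ∧ reg.HasMassScaling ∧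
      (reg.scheme 0 0 0).HasAsymptoticScaling :=
  ⟨QCDRegularisation.canonicalAF Nf, fun _ => le_rfl, QCDRegularisation.canonicalAF_hasMassScaling,
    QCDScheme.zeroAF_hasAsymptoticScaling⟩

/-! ## The junk line probes the tip -/

/-- For asymptotically free flavour numbers the mass exponent `γ₀/(2β₀)` is non-negative. -/
theorem massExponent_nonneg {Nf : ℕ} (hNf : Nf ≤ 16) : 0 ≤ massExponent Nf := by
  unfold massExponent gammaCoeff₀ betaCoeff₀
  have : (Nf : ℝ) ≤ 16 := by exact_mod_cast hNf
  apply div_nonneg (by positivity)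
  apply mul_nonneg zero_le_two
  exact div_nonneg (by linarith) (by positivity)

/-- **The window scale vanishes**: under mass scaling (`N_f ≤ 16`), `a_k / Z_m(k) → 0` — the mass
renormalisation `Z_m(k) ≍ c (log a_k⁻²)^{γ₀/(2β₀)}` is eventually bounded below while `a_k → 0`. -/
theorem tendsto_a_div_Zm {Nf : ℕ} (hNf : Nf ≤ 16) (reg : QCDRegularisation Nf)
    (hms : reg.HasMassScaling) : Tendsto (fun k => reg.a k / reg.Zm k) atTop (𝓝 0) := by
  obtain ⟨c, hc, hZ⟩ := hms
  have hlog : ∀ᶠ k in atTop, 1 ≤ Real.log (1 / reg.a k ^ 2) := by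
    have ha : ∀ᶠ k in atTop, reg.a k < 1 / 2 :=
      reg.tendsto_a.eventually (gt_mem_nhds (by norm_num))
    filter_upwards [ha] with k hk
    have hpos := reg.a_pos k
    rw [Real.le_log_iff_exp_le (by positivity)]
    have h3 : Real.exp 1 ≤ 3 := by have := Real.exp_one_lt_d9; linarith
    refine h3.trans ?_
    rw [le_div_iff₀ (by positivity)]
    nlinarith
  have hZge : ∀ᶠ k in atTop, c / 2 ≤ reg.Zm k := by
    have h1 : ∀ᶠ k in atTop, c / 2 < reg.Zm k / Real.log (1 / reg.a k ^ 2) ^ massExponent Nf :=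
      hZ.eventually (lt_mem_nhds (half_lt_self hc))
    filter_upwards [h1, hlog] with k hk hl
    have hpow : 1 ≤ Real.log (1 / reg.a k ^ 2) ^ massExponent Nf :=
      Real.one_le_rpow hl (massExponent_nonneg hNf)
    have hpow0 : 0 < Real.log (1 / reg.a k ^ 2) ^ massExponent Nf := by linarith
    rw [lt_div_iff₀ hpow0] at hk
    nlinarith
  have hup : Tendsto (fun k => 2 / c * reg.a k) atTop (𝓝 0) := by
    simpa using reg.tendsto_a.const_mul (2 / c)
  refine tendsto_of_tendsto_of_tendsto_of_le_of_le' tendsto_const_nhds hup ?_ ?_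
  · exact Eventually.of_forall fun k => (div_pos (reg.a_pos k) (reg.Zm_pos k)).le
  · filter_upwards [hZge] with k hk
    have ha := (reg.a_pos k).le
    calc reg.a k / reg.Zm k ≤ reg.a k / (c / 2) := div_le_div_of_nonneg_left ha (by positivity) hk
      _ = 2 / c * reg.a k := by field_simp

/-- Hence every probe/window offset `a_k M / Z_m(k)` tends to `0`. -/
theorem tendsto_window {Nf : ℕ} (hNf : Nf ≤ 16) (reg : QCDRegularisation Nf)
    (hms : reg.HasMassScaling) (M : ℝ) :
    Tendsto (fun k => reg.a k * M / reg.Zm k) atTop (𝓝 0) := by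
  have h := (tendsto_a_div_Zm hNf reg hms).mul_const M
  rw [zero_mul] at h
  refine h.congr fun k => ?_
  ring

/-- **A free-side TIGHT witness probes the tip of the hole.**  If `m_crit ≥ 0`, mass scaling holds
(`N_f ≤ 16`) and the TIGHT clause holds at threshold `M₀`, then for every `M > M₀`: eventually the probe
mass `m_crit(k) − a_k M/Z_m(k)` lies in `[−a_k M/Z_m(k), 0]` (upper end: the pin
`Tight.eventually_probe_mem`), it tends to `0`, and so does `m_crit(k)` itself.  So the junk line's TIGHT
integrand is the index of `Γ₅ D_W(U, −w_k, 1)` with `0 ≤ w_k ≤ a_k M/Z_m(k) → 0`: net real modes of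
`D_W(U,0,1)` in `[0, w_k]`, a window collapsing onto the tip `0`. -/
theorem freeSide_tight_probe {Nf : ℕ} (hNf : Nf ≤ 16) (reg : QCDRegularisation Nf)
    (hcrit : ∀ k, 0 ≤ reg.mcrit k) (hms : reg.HasMassScaling) (M₀ : ℝ) (m : Fin Nf → ℝ)
    (hT : Tight Nf reg M₀ m) (M : ℝ) (hM : M₀ < M) :
    (∀ᶠ k : ℕ in atTop, -(reg.a k * M / reg.Zm k) ≤ reg.mcrit k - reg.a k * M / reg.Zm k ∧
        reg.mcrit k - reg.a k * M / reg.Zm k ≤ 0) ∧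
      Tendsto (fun k => reg.mcrit k - reg.a k * M / reg.Zm k) atTop (𝓝 0) ∧
      Tendsto reg.mcrit atTop (𝓝 0) := by
  have hpin : ∀ᶠ k : ℕ in atTop, reg.mcrit k - reg.a k * M / reg.Zm k ≤ 0 :=
    (Tight.eventually_probe_mem reg M₀ m hT hM).mono fun k hk => hk.2
  have hw := tendsto_window hNf reg hms M
  have hev : ∀ᶠ k : ℕ in atTop, -(reg.a k * M / reg.Zm k) ≤ reg.mcrit k - reg.a k * M / reg.Zm k ∧
      reg.mcrit k - reg.a k * M / reg.Zm k ≤ 0 := by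
    filter_upwards [hpin] with k hk
    exact ⟨by linarith [hcrit k], hk⟩
  refine ⟨hev, ?_, ?_⟩
  · exact tendsto_of_tendsto_of_tendsto_of_le_of_le' (by simpa using hw.neg) tendsto_const_nhds
      (hev.mono fun k hk => hk.1) (hev.mono fun k hk => hk.2)
  · refine tendsto_of_tendsto_of_tendsto_of_le_of_le' tendsto_const_nhds hw
      (Eventually.of_forall hcrit) ?_
    filter_upwards [hpin] with k hk
    linarith

/-! ### A natural strengthening refuted: TIGHT cannot be uniform in the probe -/

/-- **TIGHT cannot be uniform in the probe `M`.**  For EVERY regularisation, threshold and mass tuple,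
the clause obtained from TIGHT by swapping `∀ M > M₀, ∀ᶠ k` into `∀ᶠ k, ∀ M > M₀` is FALSE: at any
fixed `k`, probes `M ≥ (m_crit(k) + 9) Z_m(k)/a_k` put the probe mass below the Wilson band (`< −8`),
where the index vanishes identically (`negCount_hermitianWilson_eq`), so the ratio is `0 < 1`.  Hence the
`k`-threshold of TIGHT necessarily depends on `M` (the probe must stay inside the hole,
`M ≲ (m_crit(k) + 8) Z_m(k)/a_k`), and no repair of item 8964 may ask for uniformity in `M`. -/
theorem not_uniform_tight {Nf : ℕ} (reg : QCDRegularisation Nf) (M₀ : ℝ) (m : Fin Nf → ℝ) :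
    ¬ ∀ᶠ k : ℕ in Filter.atTop, ∀ M : ℝ, M₀ < M → 1 ≤ (∫ U, (|(Multiset.countP (fun z : ℂ => z.re < 0) (spinorLift gammaFive * wilsonDirac (fundamentalRep (Fin 3)) U (reg.mcrit k - reg.a k * M / reg.Zm k) 1).charpoly.roots : ℝ) - 6 * (2 * reg.L k + 1 : ℝ) ^ 4|) * ∏ f : Fin Nf, ‖fermionDet (wilsonDirac (fundamentalRep (Fin 3)) U (reg.mcrit k + reg.a k * m f / reg.Zm k) 1)‖ ∂(wilsonMeasure (d := 4) (L := 2 * reg.L k + 1) (fundamentalRep (Fin 3)) (reg.β k))) / (∫ U, ∏ f : Fin Nf, ‖fermionDet (wilsonDirac (fundamentalRep (Fin 3)) U (reg.mcrit k + reg.a k * m f / reg.Zm k) 1)‖ ∂(wilsonMeasure (d := 4) (L := 2 * reg.L k + 1) (fundamentalRep (Fin 3)) (reg.β k))) := by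
  intro h
  obtain ⟨k, hk⟩ := h.exists
  set M : ℝ := max (M₀ + 1) ((reg.mcrit k + 9) * reg.Zm k / reg.a k) with hMdef
  have hM₀ : M₀ < M := lt_of_lt_of_le (lt_add_one M₀) (le_max_left _ _)
  have hprobe : reg.mcrit k - reg.a k * M / reg.Zm k < -8 := by
    have ha := reg.a_pos k
    have hZ := reg.Zm_pos k
    have hM : (reg.mcrit k + 9) * reg.Zm k / reg.a k ≤ M := le_max_right _ _
    rw [div_le_iff₀ ha] at hM
    have h9 : reg.mcrit k + 9 ≤ reg.a k * M / reg.Zm k := by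
      rw [le_div_iff₀ hZ]
      linarith
    linarith
  have h1 := hk M hM₀
  simp only [negCount_hermitianWilson_eq (Or.inr hprobe), Nat.cast_mul, Nat.cast_pow, Nat.cast_add,
    Nat.cast_ofNat, Nat.cast_one, sub_self, abs_zero, zero_mul, integral_zero, zero_div] at h1
  exact absurd h1 (by norm_num)

end Summit.QuantumFields.QCD.Theorems.TipPricing.Negative

end
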